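import Literature.NumberTheory.Kottwitz1992.SemisimpleCategories
import Literature.CategoryTheory.Abelian.FiniteLengthCompositionSeries
import Literature.RingTheory.SimpleModule.SemisimpleOfSemisimpleEndomorphismRings
import HarnessLib

/-!
# [Kottwitz1992, Lemma 3.1 p. 383] A finite-length abelian category all of whose endomorphism rings are semisimple is
# semisimple — DISCHARGED: `Kottwitz1992_3_1_semisimple_of_end_semisimple_holds`

Kernel-lane companion of the statement carpet ★ `Literature/NumberTheory/Kottwitz1992/SemisimpleCategories.lean` (squad TK,
HCML «GO 500»): the named fact ★ `SemisimpleCategories.Kottwitz1992_3_1_semisimple_of_end_semisimple` — for an abelian category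
`𝒞` (with finite biproducts) in which every object has finite length, «Suppose that for every object `X` of `𝒞` the endomorphism
ring `End(X)` is semisimple.  Then `𝒞` is semisimple» (every object is a finite direct sum of simple objects,
`Literature.CategoryTheory.KrullSchmidt.IsSemisimpleObj`) — is PROVED here, AS PRINTED, for an arbitrary abelian category.
THEOREMS ONLY (no definition, no named fact, no `sorry`, no instance, no notation); cell hodgecm-mathlib, seat B-typ02 (g32);
net debt −1.  (The MODULE case — finite-length modules over a ring — was already the tree's theorem
`Literature.RingTheory.SimpleModule.isSemisimpleModule_of_forall_isSemisimpleRing_moduleEnd`; this file lifts the same argument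
to the abelian-category carrier of the print, using the tree's subobject-lattice library `Literature/CategoryTheory/Abelian/*`.)

R. E. Kottwitz, *Points on some Shimura varieties over finite fields*, J. Amer. Math. Soc. 5 (1992) 373–444, Lemma 3.1 p. 383
(held `paper:doi-10-2307-2152772`, p0011 L8–L33).  THE PRINTED PROOF: «We prove that any object `Y` of `𝒞` is semisimple by
induction on the length of `Y`.  If the length is `0` or `1`, there is nothing to do; so we assume that the length is strictly
greater than `1`.  Let `Z` be a subobject of `Y` such that the quotient `X := Y/Z` is simple, and let `p` be the canonical map from
`Y` to `X`.  By the induction hypothesis `Z` is semisimple.  We will assume that `Y` is not semisimple and get a contradiction.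
Every simple subobject of `Y` must be contained in `Z` (otherwise we could write `Y` as the direct sum of `Z` and the simple
subobject).  Therefore `Z` can be characterized as the sum of all the simple subobjects of `Y`.  Therefore any endomorphism of `Y`
preserves `Z`.  Hence we get a homomorphism from `End(Y)` to `End(Z) × End(X)`, whose kernel is `Hom(X, Z)` with multiplication
given by `fg = 0` for all `f, g ∈ Hom(X, Z)`.  On the other hand this kernel is a two-sided ideal in the semisimple ring `End(Y)`,
and therefore `Hom(X, Z) = 0`.  Our next step is to show that `Hom(X, Y) = 0`.  Let `f ∈ Hom(X, Y)`.  If `p ∘ f ≠ 0`, then since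
`End(X)` is a division ring, we could modify `f` on the right so as to get a new `f` with `p ∘ f = id_X`.  Then `Y` would be the
direct sum of `Z` and `X`, and hence would be semisimple, a contradiction.  Therefore `p ∘ f = 0`, which just says that `f` factors
through the subobject `Z` of `Y`.  Since we already know that `Hom(X, Z) = 0`, we conclude that `f = 0`, as desired.  Now
consider the ring `End(X ⊕ Y)`.  Since `Hom(X, Y) = 0`, the semisimple ring `End(X ⊕ Y)` has as two-sided ideal the group
`Hom(Y, X)` with the zero multiplication law, and therefore `Hom(Y, X) = 0`.  This is a contradiction, since `p` is a nonzero
element of `Hom(Y, X)`.»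

THE PROOF FOLLOWED, and where we deviate (exactly as in the tree's module-case file, whose lemma structure is mirrored one for
one): (i) «every simple subobject of `Y` lies in `Z`» and «any endomorphism of `Y` preserves `Z`» are both instances of ONE remark
— a SEMISIMPLE subobject `N ⊆ Y` not contained in the maximal subobject `Z` has `N ⊔ Z = Y`, and `N ⊔ Z`, the image of
`N ⊞ Z → Y`, is semisimple (★ `KrullSchmidt.IsSemisimpleObj.biprod`/`.of_epi`, ★ `sup_eq_imageSubobject_biprod_desc`),
contradicting the standing assumption; it is applied to `N` simple, to `N = f(Z)` (the image of the semisimple `Z`) and to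
`N = f(X)` for `f ∈ Hom(X, Y)` (the image of the simple `X`) — the last replaces Kottwitz's splitting `p ∘ f = id_X` (so
`End(X)` being a division ring is not needed); (ii) the ring-theoretic input «a two-sided ideal with zero multiplication in a
semisimple ring is `0`» is used for LEFT ideals (★ `Literature.RingTheory.SimpleModule.eq_zero_of_mem_of_forall_mul_eq_zero`:
a left ideal of a semisimple ring is generated by an idempotent).  The kernel `Hom(X, Z)` is the left ideal
`{g ∈ End(Y) | Z ↪ Y →g Y = 0, Y →g Y ↠ X = 0}`, and `Hom(Y, X) ⊆ End(X ⊕ Y)` is `{F | inl ≫ F = 0, F ≫ snd = 0}`; «`p` is a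
nonzero element» = `𝟙_X ≠ 0` for the simple `X` (Mathlib `id_nonzero`) and `p` epi.  The induction runs on the tree's length
`KrullSchmidt.length Y ∈ ℕ∞` (★ `length_eq_length_add_length_cokernel`, `length_eq_one_iff`), the maximal subobject `Z` being a
coatom of `Subobject Y` (coatomic because `Y` is noetherian; `Y/Z` simple by ★ `simple_cokernel_iff_isCoatom`).
HONEST LABEL: HC_CM is proved only modulo the 7 printed citations (2 remaining: hLiu418, h413) until rung 0 closes; this file adds
no citation debt (0 facts, 0 sorry) and discharges 1 named fact of ★ `SemisimpleCategories`; it is off the HC_CM cone.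

## What is proved (`C` abelian with finite biproducts; namespace `…SemisimpleCategories.Lemma31` for the steps)
* `isSemisimpleObj_sup` (`N ⊔ Z` semisimple for `N`, `Z` semisimple subobjects), `isSemisimpleObj_of_top`,
  `le_of_isCoatom_of_isSemisimpleObj` («every [semi]simple subobject of `Y` must be contained in `Z`»), `le_of_isCoatom_of_isAtom`
  (the printed simple-subobject form), `factors_arrow_comp` ∕ `exists_comp_arrow_eq` («any endomorphism of `Y` preserves `Z`»),
  `eq_zero_of_arrow_comp_eq_zero_of_comp_cokernel_π_eq_zero` («`Hom(X, Z) = 0`»), `eq_zero_of_arrow_comp_eq_zero` ∕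
  `cokernel_hom_eq_zero` («`Hom(X, Y) = 0`»), **`isSemisimpleObj_of_isCoatom`** (the contradiction in `End(X ⊕ Y)`, length-free
  core: `Z` a semisimple coatom, `End(Y)` and `End(Y∕Z ⊕ Y)` semisimple ⟹ `Y` semisimple).
* **`Kottwitz1992_3_1_semisimple_of_end_semisimple_holds`** — the named fact, by strong induction on `ℓ(Y)`.

## References
* [Kottwitz1992] R. E. Kottwitz, Points on some Shimura varieties over finite fields, J. Amer. Math. Soc. 5 (1992) 373–444,
  §3 Lemma 3.1 (p. 383).
-/

open CategoryTheory CategoryTheory.Limits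
open Literature.CategoryTheory.KrullSchmidt

namespace Literature.NumberTheory.Kottwitz1992.SemisimpleCategories

universe v u

namespace Lemma31

variable {C : Type u} [Category.{v} C] [Abelian C] [HasFiniteBiproducts C]

/-! ## The one remark behind «simple subobjects lie in `Z`» and «endomorphisms preserve `Z`» -/

/-- The join of two semisimple subobjects is semisimple: `N ⊔ Z` is the image of `N ⊞ Z → Y`, a quotient of a semisimple
object. [cite: Kottwitz1992, §3 Lemma 3.1 (proof, p. 383)] -/
theorem isSemisimpleObj_sup {Y : C} {x z : Subobject Y} (hx : IsSemisimpleObj (x : C)) (hz : IsSemisimpleObj (z : C)) :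
    IsSemisimpleObj ((x ⊔ z : Subobject Y) : C) := by
  rw [sup_eq_imageSubobject_biprod_desc]
  exact (hx.biprod hz).of_epi (factorThruImageSubobject (biprod.desc x.arrow z.arrow))

/-- `Y` is semisimple as soon as its top subobject is. [cite: Kottwitz1992, §3 Lemma 3.1 (proof, p. 383)] -/
theorem isSemisimpleObj_of_top {Y : C} (h : IsSemisimpleObj ((⊤ : Subobject Y) : C)) : IsSemisimpleObj Y :=
  h.of_epi (⊤ : Subobject Y).arrow

/-- «Every simple subobject of `Y` must be contained in `Z` (otherwise we could write `Y` as the direct sum of `Z` and the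
simple subobject)», in the form that covers all three uses: if `Y` is NOT semisimple and the coatom `Z ⊆ Y` (`Y∕Z` simple) is
semisimple, then every SEMISIMPLE subobject `N ⊆ Y` lies in `Z` — otherwise `N ⊔ Z = Y` would be semisimple.
[cite: Kottwitz1992, §3 Lemma 3.1 (proof, p. 383)] -/
theorem le_of_isCoatom_of_isSemisimpleObj {Y : C} {z : Subobject Y} (hz : IsCoatom z) (hzss : IsSemisimpleObj (z : C))
    (hY : ¬ IsSemisimpleObj Y) {n : Subobject Y} (hn : IsSemisimpleObj (n : C)) : n ≤ z := by
  by_contra hnz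
  have hlt : z < n ⊔ z := lt_of_le_of_ne le_sup_right fun h => hnz (le_sup_left.trans h.ge)
  have hsup : n ⊔ z = ⊤ := hz.2 _ hlt
  have htop : IsSemisimpleObj ((⊤ : Subobject Y) : C) := by
    rw [← hsup]
    exact isSemisimpleObj_sup hn hzss
  exact hY (isSemisimpleObj_of_top htop)

/-- The printed form: every SIMPLE subobject (atom of the subobject lattice) of a non-semisimple `Y` lies in the semisimple
maximal subobject `Z`. [cite: Kottwitz1992, §3 Lemma 3.1 (proof, p. 383)] -/
theorem le_of_isCoatom_of_isAtom {Y : C} {z : Subobject Y} (hz : IsCoatom z) (hzss : IsSemisimpleObj (z : C))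
    (hY : ¬ IsSemisimpleObj Y) {a : Subobject Y} (ha : IsAtom a) : a ≤ z :=
  haveI : Simple (a : C) := (subobject_simple_iff_isAtom a).mpr ha
  le_of_isCoatom_of_isSemisimpleObj hz hzss hY (isSemisimpleObj_of_simple (a : C))

/-- The image of a morphism out of a semisimple object is a semisimple subobject of the target.
[cite: Kottwitz1992, §3 Lemma 3.1 (proof, p. 383)] -/
theorem isSemisimpleObj_imageSubobject {A Y : C} (f : A ⟶ Y) (hA : IsSemisimpleObj A) :
    IsSemisimpleObj ((imageSubobject f : Subobject Y) : C) :=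
  hA.of_epi (factorThruImageSubobject f)

omit [HasFiniteBiproducts C] in
/-- A morphism factors through its image subobject. [cite: Kottwitz1992, §3 Lemma 3.1 (proof, p. 383)] -/
theorem imageSubobject_factors {A Y : C} (f : A ⟶ Y) : (imageSubobject f).Factors f := by
  have h := Subobject.factors_comp_arrow (P := imageSubobject f) (factorThruImageSubobject f)
  rwa [imageSubobject_arrow_comp] at h

/-- «Therefore any endomorphism of `Y` preserves `Z`»: `Z ↪ Y →f Y` factors through `Z` for every `f ∈ End(Y)` (its image is a
quotient of the semisimple `Z`, hence semisimple, hence inside `Z`). [cite: Kottwitz1992, §3 Lemma 3.1 (proof, p. 383)] -/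
theorem factors_arrow_comp {Y : C} {z : Subobject Y} (hz : IsCoatom z) (hzss : IsSemisimpleObj (z : C))
    (hY : ¬ IsSemisimpleObj Y) (f : Y ⟶ Y) : z.Factors (z.arrow ≫ f) :=
  Subobject.factors_of_le _
    (le_of_isCoatom_of_isSemisimpleObj hz hzss hY (isSemisimpleObj_imageSubobject (z.arrow ≫ f) hzss))
    (imageSubobject_factors _)

/-- «Any endomorphism of `Y` preserves `Z`», as a commuting square `t ≫ (Z ↪ Y) = (Z ↪ Y) ≫ f` (this is the homomorphism
`End(Y) → End(Z)`, `f ↦ t`). [cite: Kottwitz1992, §3 Lemma 3.1 (proof, p. 383)] -/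
theorem exists_comp_arrow_eq {Y : C} {z : Subobject Y} (hz : IsCoatom z) (hzss : IsSemisimpleObj (z : C))
    (hY : ¬ IsSemisimpleObj Y) (f : Y ⟶ Y) : ∃ t : (z : C) ⟶ (z : C), t ≫ z.arrow = z.arrow ≫ f :=
  ⟨z.factorThru _ (factors_arrow_comp hz hzss hY f), Subobject.factorThru_arrow _ _ _⟩

/-! ## `Hom(X, Z) = 0` and `Hom(X, Y) = 0` -/

/-- «Hence we get a homomorphism from `End(Y)` to `End(Z) × End(X)`, whose kernel is `Hom(X, Z)` with multiplication given by
`fg = 0` … this kernel is a two-sided ideal in the semisimple ring `End(Y)`, and therefore `Hom(X, Z) = 0`»: an endomorphism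
`g` of `Y` vanishing on `Z` and vanishing modulo `Z` (i.e. factoring as `Y ↠ X → Z ↪ Y`) is zero.  (The set of such `g` is a
left ideal of `End(Y)` by `exists_comp_arrow_eq`, and the product of any two of its members is `0`.)
[cite: Kottwitz1992, §3 Lemma 3.1 (proof, p. 383)] -/
theorem eq_zero_of_arrow_comp_eq_zero_of_comp_cokernel_π_eq_zero {Y : C} [IsSemisimpleRing (End Y)] {z : Subobject Y}
    (hz : IsCoatom z) (hzss : IsSemisimpleObj (z : C)) (hY : ¬ IsSemisimpleObj Y) {g : Y ⟶ Y}
    (hg₁ : z.arrow ≫ g = 0) (hg₂ : g ≫ cokernel.π z.arrow = 0) : g = 0 := by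
  -- the kernel `Hom(X, Z)` of `End(Y) → End(Z) × End(X)`, as a left ideal of `End(Y)`
  let K : Ideal (End Y) :=
    { carrier := {g | z.arrow ≫ g = 0 ∧ g ≫ cokernel.π z.arrow = 0}
      add_mem' := by
        rintro a b ⟨ha₁, ha₂⟩ ⟨hb₁, hb₂⟩
        -- (`a + b` is the sum in `End Y`, definitionally the sum of morphisms)
        exact ⟨(Preadditive.comp_add _ _ _ z.arrow a b).trans (by rw [ha₁, hb₁, add_zero]),
          (Preadditive.add_comp _ _ _ a b (cokernel.π z.arrow)).trans (by rw [ha₂, hb₂, add_zero])⟩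
      zero_mem' := ⟨comp_zero, zero_comp⟩
      smul_mem' := by
        rintro c a ⟨ha₁, ha₂⟩
        -- `c • a = a ≫ c`
        refine ⟨?_, ?_⟩
        · change z.arrow ≫ (a ≫ c) = 0
          rw [← Category.assoc, ha₁]
          exact zero_comp
        · change (a ≫ c) ≫ cokernel.π z.arrow = 0
          -- `a` factors through `Z` (it vanishes modulo `Z`), and `c` maps `Z` into `Z`
          obtain ⟨t, ht⟩ := exists_comp_arrow_eq hz hzss hY c
          have hfa : z.Factors a := factors_of_comp_cokernel_π_eq_zero z a ha₂
          have key : z.arrow ≫ c ≫ cokernel.π z.arrow = 0 := by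
            rw [← Category.assoc, ← ht, Category.assoc, cokernel.condition]
            exact comp_zero
          rw [← z.factorThru_arrow a hfa, Category.assoc, Category.assoc, key]
          exact comp_zero }
  have hsq : ∀ x ∈ K, ∀ y ∈ K, x * y = 0 := by
    rintro x ⟨hx₁, -⟩ y ⟨-, hy₂⟩
    rw [End.mul_def]
    have hfy : z.Factors y := factors_of_comp_cokernel_π_eq_zero z y hy₂
    have h : y ≫ x = 0 := by
      rw [← z.factorThru_arrow y hfy, Category.assoc, hx₁]
      exact comp_zero
    exact h
  exact Literature.RingTheory.SimpleModule.eq_zero_of_mem_of_forall_mul_eq_zero hsq (show g ∈ K from ⟨hg₁, hg₂⟩)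

/-- «Our next step is to show that `Hom(X, Y) = 0`»: an endomorphism `f` of `Y` vanishing on `Z` is zero.  (`f` factors through
the simple `X = Y ∕ Z`, so its image is semisimple, hence inside `Z` by `le_of_isCoatom_of_isSemisimpleObj` — this replaces the
printed splitting `p ∘ f = id_X` — and then `f ∈ Hom(X, Z) = 0`.) [cite: Kottwitz1992, §3 Lemma 3.1 (proof, p. 383)] -/
theorem eq_zero_of_arrow_comp_eq_zero {Y : C} [IsSemisimpleRing (End Y)] {z : Subobject Y} (hz : IsCoatom z)
    (hzss : IsSemisimpleObj (z : C)) (hY : ¬ IsSemisimpleObj Y) {f : Y ⟶ Y} (hf : z.arrow ≫ f = 0) : f = 0 := by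
  haveI : Simple (cokernel z.arrow) := (simple_cokernel_iff_isCoatom z).2 hz
  -- `Y → f(Y)` vanishes on `Z`, so `f(Y)` is a quotient of the simple `X = Y ∕ Z`
  have he : z.arrow ≫ factorThruImageSubobject f = 0 := by
    rw [← cancel_mono (imageSubobject f).arrow, Category.assoc, imageSubobject_arrow_comp, hf]
    exact zero_comp.symm
  have hw : cokernel.π z.arrow ≫ cokernel.desc z.arrow _ he = factorThruImageSubobject f := cokernel.π_desc _ _ _
  haveI : Epi (cokernel.desc z.arrow _ he) := epi_of_epi_fac hw
  have himg : IsSemisimpleObj ((imageSubobject f : Subobject Y) : C) :=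
    (isSemisimpleObj_of_simple (cokernel z.arrow)).of_epi (cokernel.desc z.arrow _ he)
  -- hence `f(Y) ⊆ Z`, i.e. `f` vanishes modulo `Z`
  have hfz : z.Factors f := Subobject.factors_of_le f (le_of_isCoatom_of_isSemisimpleObj hz hzss hY himg)
    (imageSubobject_factors f)
  have hf₂ : f ≫ cokernel.π z.arrow = 0 := by
    rw [← z.factorThru_arrow f hfz, Category.assoc, cokernel.condition]
    exact comp_zero
  exact eq_zero_of_arrow_comp_eq_zero_of_comp_cokernel_π_eq_zero hz hzss hY hf hf₂

/-- «`Hom(X, Y) = 0`» in quotient form: every morphism `X = Y ∕ Z → Y` is zero.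
[cite: Kottwitz1992, §3 Lemma 3.1 (proof, p. 383)] -/
theorem cokernel_hom_eq_zero {Y : C} [IsSemisimpleRing (End Y)] {z : Subobject Y} (hz : IsCoatom z)
    (hzss : IsSemisimpleObj (z : C)) (hY : ¬ IsSemisimpleObj Y) (φ : cokernel z.arrow ⟶ Y) : φ = 0 := by
  have h : cokernel.π z.arrow ≫ φ = 0 :=
    eq_zero_of_arrow_comp_eq_zero hz hzss hY (by rw [← Category.assoc, cokernel.condition]; exact zero_comp)
  rw [← cancel_epi (cokernel.π z.arrow), h]
  exact comp_zero.symm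

/-! ## The contradiction in `End(X ⊕ Y)` -/

/-- **The core of Lemma 3.1, length-free.**  Let `Z ⊆ Y` be a maximal subobject (`Y ∕ Z` simple) which is semisimple, and
suppose the rings `End(Y)` and `End(Y∕Z ⊕ Y)` are semisimple.  Then `Y` is semisimple: otherwise «since `Hom(X, Y) = 0`, the
semisimple ring `End(X ⊕ Y)` has as two-sided ideal the group `Hom(Y, X)` with the zero multiplication law, and therefore
`Hom(Y, X) = 0`.  This is a contradiction, since `p` is a nonzero element of `Hom(Y, X)`.»
[cite: Kottwitz1992, §3 Lemma 3.1 (proof, p. 383)] -/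
theorem isSemisimpleObj_of_isCoatom {Y : C} [IsSemisimpleRing (End Y)] (z : Subobject Y) (hz : IsCoatom z)
    (hzss : IsSemisimpleObj (z : C)) [IsSemisimpleRing (End (cokernel z.arrow ⊞ Y))] : IsSemisimpleObj Y := by
  by_contra hY
  haveI : Simple (cokernel z.arrow) := (simple_cokernel_iff_isCoatom z).2 hz
  -- `Hom(X, Y) = 0`
  have hXY : ∀ φ : cokernel z.arrow ⟶ Y, φ = 0 := fun φ => cokernel_hom_eq_zero hz hzss hY φ
  -- an endomorphism of `X ⊞ Y` landing in `X ⊞ 0` is `F ≫ fst ≫ inl`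
  have hfst : ∀ F : cokernel z.arrow ⊞ Y ⟶ cokernel z.arrow ⊞ Y, F ≫ biprod.snd = 0 →
      F ≫ biprod.fst ≫ biprod.inl = F := by
    intro F hF
    calc F ≫ biprod.fst ≫ biprod.inl
          = F ≫ biprod.fst ≫ biprod.inl + (F ≫ biprod.snd) ≫ biprod.inr := by rw [hF, zero_comp, add_zero]
      _ = F ≫ (biprod.fst ≫ biprod.inl + biprod.snd ≫ biprod.inr) := by rw [Preadditive.comp_add, Category.assoc]
      _ = F := by rw [biprod.total, Category.comp_id]
  -- the ideal `Hom(Y, X)` of `End(X ⊕ Y)`: endomorphisms `F` with `F(X ⊕ 0) = 0` and `F(X ⊕ Y) ⊆ X ⊕ 0`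
  let J : Ideal (End (cokernel z.arrow ⊞ Y)) :=
    { carrier := {F | biprod.inl ≫ F = 0 ∧ F ≫ biprod.snd = 0}
      add_mem' := by
        rintro a b ⟨ha₁, ha₂⟩ ⟨hb₁, hb₂⟩
        exact ⟨(Preadditive.comp_add _ _ _ biprod.inl a b).trans (by rw [ha₁, hb₁, add_zero]),
          (Preadditive.add_comp _ _ _ a b biprod.snd).trans (by rw [ha₂, hb₂, add_zero])⟩
      zero_mem' := ⟨comp_zero, zero_comp⟩
      smul_mem' := by
        rintro G F ⟨hF₁, hF₂⟩
        -- `G • F = F ≫ G`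
        refine ⟨?_, ?_⟩
        · change biprod.inl ≫ (F ≫ G) = 0
          rw [← Category.assoc, hF₁]
          exact zero_comp
        · change (F ≫ G) ≫ biprod.snd = 0
          -- `F ≫ G ≫ snd = F ≫ fst ≫ (inl ≫ G ≫ snd)` and `inl ≫ G ≫ snd ∈ Hom(X, Y) = 0`
          rw [← hfst F hF₂, Category.assoc, Category.assoc, Category.assoc, hXY (biprod.inl ≫ G ≫ biprod.snd), comp_zero]
          exact comp_zero }
  have hsq : ∀ F ∈ J, ∀ F' ∈ J, F * F' = 0 := by
    rintro F ⟨hF₁, -⟩ F' ⟨-, hF'₂⟩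
    rw [End.mul_def]
    have h : F' ≫ F = 0 := by
      rw [← hfst F' hF'₂, Category.assoc, Category.assoc, hF₁, comp_zero]
      exact comp_zero
    exact h
  -- `p : Y → X`, placed in `End(X ⊕ Y)` as `snd ≫ p ≫ inl`, lies in `J`, hence vanishes
  let P : End (cokernel z.arrow ⊞ Y) := biprod.snd ≫ cokernel.π z.arrow ≫ biprod.inl
  have hP : P ∈ J := by
    refine ⟨?_, ?_⟩
    · change biprod.inl ≫ biprod.snd ≫ cokernel.π z.arrow ≫ biprod.inl = 0
      rw [← Category.assoc, biprod.inl_snd]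
      exact zero_comp
    · change (biprod.snd ≫ cokernel.π z.arrow ≫ biprod.inl) ≫ biprod.snd = 0
      rw [Category.assoc, Category.assoc, biprod.inl_snd, comp_zero]
      exact comp_zero
  have hP0 : P = 0 := Literature.RingTheory.SimpleModule.eq_zero_of_mem_of_forall_mul_eq_zero hsq hP
  -- but then `p = inr ≫ P ≫ fst = 0`, while `p` is an epimorphism onto the non-zero object `X`
  have hp : biprod.inr ≫ P ≫ biprod.fst = cokernel.π z.arrow := by
    change biprod.inr ≫ (biprod.snd ≫ cokernel.π z.arrow ≫ biprod.inl) ≫ biprod.fst = cokernel.π z.arrow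
    rw [Category.assoc, Category.assoc, biprod.inl_fst, Category.comp_id, ← Category.assoc, biprod.inr_snd,
      Category.id_comp]
  have hp0 : cokernel.π z.arrow = 0 := by
    rw [← hp, hP0]
    change biprod.inr ≫ (0 : cokernel z.arrow ⊞ Y ⟶ cokernel z.arrow ⊞ Y) ≫ biprod.fst = 0
    rw [zero_comp]
    exact comp_zero
  have hid : 𝟙 (cokernel z.arrow) = 0 := by
    rw [← cancel_epi (cokernel.π z.arrow), hp0, zero_comp]
    exact zero_comp.symm
  exact id_nonzero (cokernel z.arrow) hid

end Lemma31

/-! ## Lemma 3.1 as printed -/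

variable (𝒞 : Type u) [Category.{v} 𝒞] [Abelian 𝒞] [HasFiniteBiproducts 𝒞]

open Lemma31 in
/-- **KOTTWITZ 1992, LEMMA 3.1, PROVED**: ★ `Kottwitz1992_3_1_semisimple_of_end_semisimple` holds — in an abelian category in
which every object has finite length, if every endomorphism ring `End(X)` is a semisimple ring then every object is semisimple.
The printed induction on the length `ℓ(Y)`: for `Y ≠ 0` choose a maximal subobject `Z` (`X = Y∕Z` simple, so
`ℓ(Y) = ℓ(Z) + 1`); `Z` is semisimple by induction, and `Lemma31.isSemisimpleObj_of_isCoatom` (the hypothesis being used for `Y`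
and for `X ⊕ Y`) shows that `Y` is semisimple. [cite: Kottwitz1992, §3 Lemma 3.1 (p. 383)] -/
theorem Kottwitz1992_3_1_semisimple_of_end_semisimple_holds : Kottwitz1992_3_1_semisimple_of_end_semisimple 𝒞 := by
  intro hfl hEnd
  -- induction on the length, for all objects at once
  suffices main : ∀ (n : ℕ) (Y : 𝒞), length Y = n → IsSemisimpleObj Y by
    intro Y
    obtain ⟨hA, hN⟩ := hfl Y
    obtain ⟨n, hn⟩ := ENat.ne_top_iff_exists.mp (length_ne_top Y)
    exact main n Y hn.symm
  intro n
  induction n using Nat.strong_induction_on with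
  | _ n ih =>
    intro Y hn
    obtain ⟨hA, hN⟩ := hfl Y
    by_cases hY0 : IsZero Y
    · -- length `0`: «there is nothing to do»
      exact isSemisimpleObj_of_isZero hY0
    · haveI : Nontrivial (Subobject Y) := Subobject.nontrivial_of_not_isZero hY0
      -- «Let `Z` be a subobject of `Y` such that the quotient `X := Y/Z` is simple»
      obtain ⟨z, hz, -⟩ := (eq_top_or_exists_le_coatom (⊥ : Subobject Y)).resolve_left bot_ne_top
      haveI : Simple (cokernel z.arrow) := (simple_cokernel_iff_isCoatom z).2 hz
      -- «By the induction hypothesis `Z` is semisimple»: `ℓ(Y) = ℓ(Z) + 1`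
      have hlen : length Y = length (z : 𝒞) + 1 := by
        rw [length_eq_length_add_length_cokernel z, (length_eq_one_iff (cokernel z.arrow)).2 inferInstance]
      haveI : IsArtinianObject (z : 𝒞) := isArtinianObject_of_mono z.arrow
      haveI : IsNoetherianObject (z : 𝒞) := isNoetherianObject_of_mono z.arrow
      obtain ⟨m, hm⟩ := ENat.ne_top_iff_exists.mp (length_ne_top (z : 𝒞))
      have hmn : m < n := by
        have h1 : ((m + 1 : ℕ) : ℕ∞) = n := by rw [Nat.cast_add, Nat.cast_one, hm, ← hlen, hn]
        have h2 : m + 1 = n := by exact_mod_cast h1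
        omega
      have hzss : IsSemisimpleObj (z : 𝒞) := ih m hmn (z : 𝒞) hm.symm
      -- the hypothesis, used for `Y` and for `X ⊕ Y`
      haveI := hEnd Y
      haveI := hEnd (cokernel z.arrow ⊞ Y)
      exact isSemisimpleObj_of_isCoatom z hz hzss

end Literature.NumberTheory.Kottwitz1992.SemisimpleCategories
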